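import Mathlib
import Summits.NavierStokesRegularity.NavierStokesRegularity.Theorems.EulerZoomLiouvillePowerGaugeEulerLiouvilleCondenserExplicitGap
import Summits.NavierStokesRegularity.NavierStokesRegularity.Theorems.EulerZoomLiouvillePowerGaugeEulerLiouvilleCondenserSharpGaugeForm

/-!
# THEOREM K′ — EXPLICIT-GAP LIOUVILLE WITH THE CLASS-EXPLICIT THRESHOLD `κ⋆(c,ρ) = 2π/(3(1−ρ)(2+ρ)c)` (plate t47-K′,
nsreg-p2 g35 ROUND-45 §2, `r45/Sketch45.lean` `NsregP2.R45.SharpExplicitGapLiouville`)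

Width piece for crux `EulerZoomLiouville.PowerGaugeEulerLiouville` (stmt-NavierStokesRegularity-19832), by name under
LEAD 19832 (ns-typeII-p2 g13); seat ns-sfl-p1 g6, `--supports stmt-NavierStokesRegularity-19832 --as helper`.
A copy-edit of THEOREM K (`Condenser.selfSimilar_ae_eq_zero_of_smallTypeGradientC2`, ns-ezl-w2 g4 p664706) in which
t44-B (`Condenser.exists_gradient_ge_exp_rpow_of_exit`, constant `πγ²/(128·3^{1−ρ}C_E)`, `C_E = (1−ρ)c/(2+ρ) + 1`, exit
ratio 2, ball `3R`) is replaced by THEOREM B′ (`Condenser.sharpCondenserGaugeForm`, constant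
`κ_B(Λ) = 2πγ²(Λ³−1)/(3(Λ+1)^{1−ρ}C_E)`, `C_E = (1−ρ)c/(2+ρ)` exactly — hence `0 < c` —, free exit ratio `Λ`, ball
`(Λ+1)R`), read in the OUTER-RADIUS normalisation `R_out = (Λ+1)R`:

* **`selfSimilar_ae_eq_zero_of_sharpSmallTypeGradientC2`** — an exactly self-similar `C²` member of the crux class (gauge
  constant `c > 0`) whose profile gradient has, for ONE `c' < κ⋆(c,ρ) = 2π/(3(1−ρ)(2+ρ)c)`, outer type `≤ c'` along ONE
  sequence of radii (`∀ R₀ ∃ R ≥ R₀, sup_{B(0,R)}‖DV‖ ≤ e^{c'R^{2+ρ}}`) is TRIVIAL.  [Exit ratio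
  `Λ = 3κ⋆/(κ⋆ − c') + 1`, so that `c'(Λ+1)³ < κ⋆(Λ³−1)` (`(Λ+1)³ − (Λ³−1) ≤ 3(Λ+1)²`); with `R = R_out/(Λ+1)` the
  envelope `e^{c'R_out^{2+ρ}} = e^{κ''R^{2+ρ}}`, `κ'' = c'(Λ+1)^{2+ρ} < κ_B(Λ) = κ⋆(Λ³−1)/(Λ+1)^{1−ρ}`; B′ at the midpoint
  `κ_m = (κ''+κ_B)/2` forbids exits from `B(0,R)` through `‖·‖ = ΛR`; no exits ⇒ vortical points confined ⇒ null
  (`Loc.volume_vortical_confined_eq_zero`) ⇒ `curl V ≡ 0` ⇒ trivial.]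
* `sharpExplicitGapLiouville` — the Sketch45 text VERBATIM.

NUMBERS OF RECORD: `κ⋆(1,½) = 16π/30 = 1.676`; THEOREM K in this normalisation `κ_K/3^{2+ρ} ≈ 1.21·10⁻⁴`.
HONEST FRAMING: a stratum of the crux CLASS (hypothetical blow-up members, MODEL lattice); nothing here proves the crux E
(19832 OPEN), any door Target, or Navier–Stokes regularity. [nsreg-p2 ROUND-45 THEOREM K′;
cite: ConstantinIgnatovaVicol2026Putative, §3.4.1; folklore (length–area method)]
-/

noncomputable section

open Set Filter Topology Metric Function MeasureTheory Real
open scoped RealInnerProductSpace NNReal ENNReal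

set_option linter.dupNamespace false

namespace Summit.NavierStokesRegularity.NavierStokesRegularity.Theorems.PowerGaugeEulerLiouville.Condenser

open Literature.Analysis Literature.Analysis.FluidPDE
open Summit.NavierStokesRegularity.NavierStokesRegularity.Theorems.PowerGaugeEulerLiouville

/-- Exit-ratio bookkeeping: with `Λ = 3κ⋆/(κ⋆ − c') + 1` (`c' < κ⋆`, `0 < κ⋆`) one has `1 < Λ` and
`c'(Λ+1)³ < κ⋆(Λ³ − 1)`. [folklore] -/
theorem exitRatio_bookkeeping {κs c' : ℝ} (hκ : 0 < κs) (hc : c' < κs) :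
    1 < 3 * κs / (κs - c') + 1 ∧
      c' * (3 * κs / (κs - c') + 1 + 1) ^ 3 < κs * ((3 * κs / (κs - c') + 1) ^ 3 - 1) := by
  have hgap : 0 < κs - c' := sub_pos.2 hc
  have hq : 0 < 3 * κs / (κs - c') := div_pos (by positivity) hgap
  refine ⟨by linarith, ?_⟩
  -- write `M = Λ + 1`; then `(κ⋆ − c') M > 3κ⋆` and `(Λ+1)³ − (Λ³ − 1) ≤ 3 (Λ+1)²`
  have hM : (κs - c') * (3 * κs / (κs - c') + 1 + 1) = 3 * κs + 2 * (κs - c') := by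
    field_simp
    ring
  have hMpos : 0 < 3 * κs / (κs - c') + 1 + 1 := by linarith
  nlinarith [mul_pos hMpos hMpos, mul_pos (mul_pos hMpos hMpos) hgap, mul_pos (mul_pos hMpos hMpos) hκ, hM]

/-- NO EXIT under the envelope: if exits from `B(0,R)` through `‖·‖ = ΛR` force `‖DV_c‖ ≥ e^{κ_m R^{2+ρ}}` somewhere on
`B(0,(Λ+1)R)` (THEOREM B′ for the cut-off copy `V_c`), while `‖DV‖ ≤ e^{κ''R^{2+ρ}}` there with `κ'' < κ_m` and
`DV_c = DV` on that ball, then no backward orbit of the cut-off flow from `B(0,R)` reaches `‖·‖ = ΛR`. [folklore] -/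
theorem noexit_of_envelope {γ ρ : ℝ} {V Vc : EuclideanSpace ℝ (Fin 3) → EuclideanSpace ℝ (Fin 3)} {R Λ κm κ'' : ℝ}
    (hB : ∀ (y : EuclideanSpace ℝ (Fin 3)) (L : ℝ), 0 ≤ L → ‖y‖ < R →
      Λ * R ≤ ‖ODE.evolutionMap (fun _ : ℝ => selfSimilarTransport γ 0 Vc) 0 (-L) y‖ →
      ∃ z ∈ ball (0 : EuclideanSpace ℝ (Fin 3)) ((Λ + 1) * R), Real.exp (κm * R ^ (2 + ρ)) ≤ ‖fderiv ℝ Vc z‖)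
    (hfd : ∀ z ∈ ball (0 : EuclideanSpace ℝ (Fin 3)) ((Λ + 1) * R), fderiv ℝ Vc z = fderiv ℝ V z)
    (henv : ∀ z ∈ ball (0 : EuclideanSpace ℝ (Fin 3)) ((Λ + 1) * R),
      ‖fderiv ℝ V z‖ ≤ Real.exp (κ'' * R ^ (2 + ρ)))
    (hκ : κ'' < κm) (hR : 0 < R) :
    ∀ y : EuclideanSpace ℝ (Fin 3), ‖y‖ < R → ∀ L : ℝ, 0 ≤ L →
      ‖ODE.evolutionMap (fun _ : ℝ => selfSimilarTransport γ 0 Vc) 0 (-L) y‖ < Λ * R := by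
  intro y hy L hL
  by_contra hex
  push Not at hex
  obtain ⟨z, hz, hzle⟩ := hB y L hL hy hex
  rw [hfd z hz] at hzle
  have h2 := Real.exp_le_exp.1 (hzle.trans (henv z hz))
  have hRpow : 0 < R ^ (2 + ρ) := Real.rpow_pos_of_pos hR _
  nlinarith [mul_lt_mul_of_pos_right hκ hRpow]

/-- CONFINEMENT ⇒ IRROTATIONAL: if no backward orbit of a cut-off flow `V_c = V` on `B(0,(Λ+1)R)` leaves `‖·‖ < ΛR` from
`B(0,R)`, then every point of `B(0,R)` is irrotational for the profile `V` (vortical confined points are Lebesgue-null,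
`Loc.volume_vortical_confined_eq_zero`, and the vortical set is open). [folklore] -/
theorem curl_eq_zero_of_noexit {γ : ℝ} {V Vc : EuclideanSpace ℝ (Fin 3) → EuclideanSpace ℝ (Fin 3)}
    {P' : EuclideanSpace ℝ (Fin 3) → ℝ} (hprof : IsSelfSimilarEulerProfile γ 0 V P') (hγ : 0 < γ) (hγ2 : γ < 1 / 2)
    (hV : ContDiff ℝ 2 V) (hVc1 : ContDiff ℝ 1 Vc) {K : ℝ} (hK : ∀ y, ‖fderiv ℝ Vc y‖ ≤ K)
    {R Λ : ℝ} (hR : 0 < R) (hΛ : 1 < Λ)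
    (hVU : ∀ y ∈ ball (0 : EuclideanSpace ℝ (Fin 3)) ((Λ + 1) * R), Vc y = V y)
    (hnoexit : ∀ y : EuclideanSpace ℝ (Fin 3), ‖y‖ < R → ∀ L : ℝ, 0 ≤ L →
      ‖ODE.evolutionMap (fun _ : ℝ => selfSimilarTransport γ 0 Vc) 0 (-L) y‖ < Λ * R)
    {x : EuclideanSpace ℝ (Fin 3)} (hx : ‖x‖ < R) : curl V x = 0 := by
  by_contra hxc
  have hΛR : 0 < Λ * R := mul_pos (by linarith) hR
  have hnull := Loc.volume_vortical_confined_eq_zero hprof hγ hγ2 (N := Λ * R) hΛR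
  have hOopen : IsOpen (ball (0 : EuclideanSpace ℝ (Fin 3)) R ∩ {x' | curl V x' ≠ 0}) :=
    isOpen_ball.inter (isOpen_ne_fun (differentiable_curl_of_contDiff hV).continuous continuous_const)
  have hxO : x ∈ ball (0 : EuclideanSpace ℝ (Fin 3)) R ∩ {x' | curl V x' ≠ 0} := ⟨mem_ball_zero_iff.2 hx, hxc⟩
  have hOsub : ball (0 : EuclideanSpace ℝ (Fin 3)) R ∩ {x' | curl V x' ≠ 0} ⊆
      {x' : EuclideanSpace ℝ (Fin 3) | curl V x' ≠ 0 ∧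
        ∃ Y : ℝ → EuclideanSpace ℝ (Fin 3), Y 0 = x' ∧
          (∀ t, 0 ≤ t → HasDerivAt Y ((-1 : ℝ) • selfSimilarTransport γ 0 V (Y t)) t) ∧
          ∀ t, 0 ≤ t → ‖Y t‖ ≤ Λ * R} := by
    rintro x' ⟨hx'R, hx'c⟩
    refine ⟨hx'c, fun t => ODE.evolutionMap (fun _ : ℝ => selfSimilarTransport γ 0 Vc) 0 (-t) x', ?_, ?_, ?_⟩
    · simp [ODE.evolutionMap_self]
    · intro t ht
      have h := C2.Kelvin.hasDerivAt_flow_neg (γ := γ) hVc1 hK x' t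
      have hlt := hnoexit x' (mem_ball_zero_iff.1 hx'R) t ht
      have hin : ODE.evolutionMap (fun _ : ℝ => selfSimilarTransport γ 0 Vc) 0 (-t) x' ∈
          ball (0 : EuclideanSpace ℝ (Fin 3)) ((Λ + 1) * R) :=
        mem_ball_zero_iff.2 (hlt.trans (by linarith))
      have hW : selfSimilarTransport γ 0 Vc (ODE.evolutionMap (fun _ : ℝ => selfSimilarTransport γ 0 Vc) 0 (-t) x') =
          selfSimilarTransport γ 0 V (ODE.evolutionMap (fun _ : ℝ => selfSimilarTransport γ 0 Vc) 0 (-t) x') := by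
        rw [selfSimilarTransport_apply, selfSimilarTransport_apply, hVU _ hin]
      rw [hW] at h
      exact h
    · intro t ht
      exact (hnoexit x' (mem_ball_zero_iff.1 hx'R) t ht).le
  have hO0 : volume (ball (0 : EuclideanSpace ℝ (Fin 3)) R ∩ {x' | curl V x' ≠ 0}) = 0 :=
    measure_mono_null hOsub hnull
  exact (hOopen.measure_pos volume ⟨x, hxO⟩).ne' hO0

/-- **THEOREM K′ — ONE SUB-`κ⋆` OUTER TYPE ALONG ONE SEQUENCE OF RADII KILLS.**  See the module docstring.
[nsreg-p2 ROUND-45 THEOREM K′; cite: ConstantinIgnatovaVicol2026Putative, §3.4.1; folklore (length–area method)] -/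
theorem selfSimilar_ae_eq_zero_of_sharpSmallTypeGradientC2 {ρ : ℝ} (hρ : 0 < ρ) (hρ1 : ρ ≤ 1 / 2)
    {u : ℝ → EuclideanSpace ℝ (Fin 3) → EuclideanSpace ℝ (Fin 3)} {p : ℝ → EuclideanSpace ℝ (Fin 3) → ℝ}
    {H : ℝ → EuclideanSpace ℝ (Fin 3) → EuclideanSpace ℝ (Fin 3) →L[ℝ] EuclideanSpace ℝ (Fin 3)} {c : ℝ≥0}
    (hc : 0 < (c : ℝ))
    (hsw : IsSuitableWeakSolutionOn (slab (EuclideanSpace ℝ (Fin 3)) (Iio 0) isOpen_Iio) 0 0 u p)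
    (hH : HasWeakSpatialGradientOn (slab (EuclideanSpace ℝ (Fin 3)) (Iio 0) isOpen_Iio) u H)
    (hgauge : ∀ a : ℝ, 0 < a →
      ENNReal.ofReal (a ^ (2 * ρ)) * cknA a (0 : ℝ × EuclideanSpace ℝ (Fin 3)) u +
          ENNReal.ofReal (a ^ ρ) * cknE a (0 : ℝ × EuclideanSpace ℝ (Fin 3)) H +
        ENNReal.ofReal (a ^ (2 * ρ)) * cknD a (0 : ℝ × EuclideanSpace ℝ (Fin 3)) p ≤ (c : ℝ≥0∞))
    {V : EuclideanSpace ℝ (Fin 3) → EuclideanSpace ℝ (Fin 3)} {P : EuclideanSpace ℝ (Fin 3) → ℝ}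
    (hu : ∀ τ : ℝ, τ < 0 → u τ = selfSimilarCollapse (1 / (2 + ρ)) 0 V τ)
    (hp : ∀ τ : ℝ, τ < 0 → p τ = selfSimilarCollapsePressure (1 / (2 + ρ)) 0 P τ)
    (hV : ContDiff ℝ 2 V)
    (hgrad : ∃ c' : ℝ, c' < 2 * Real.pi / (3 * (1 - ρ) * (2 + ρ) * (c : ℝ)) ∧
      ∀ R₀ : ℝ, ∃ R : ℝ, R₀ ≤ R ∧
        ∀ z ∈ ball (0 : EuclideanSpace ℝ (Fin 3)) R, ‖fderiv ℝ V z‖ ≤ Real.exp (c' * R ^ (2 + ρ))) :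
    uncurry u =ᵐ[volume.restrict (Iio (0 : ℝ) ×ˢ (univ : Set (EuclideanSpace ℝ (Fin 3))))] 0 := by
  obtain ⟨c', hc'κ, hgrad⟩ := hgrad
  have hπ : 0 < Real.pi := Real.pi_pos
  have hρ1' : ρ < 1 := by linarith
  have h2ρ : (0 : ℝ) < 2 + ρ := by linarith
  have h1ρ : (0 : ℝ) < 1 - ρ := by linarith
  have hγ : (0 : ℝ) < 1 / (2 + ρ) := one_div_pos.2 h2ρ
  have hγ2 : 1 / (2 + ρ) < 1 / 2 := one_div_lt_one_div_of_lt two_pos (by linarith)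
  have hV1 : ContDiff ℝ 1 V := hV.of_le (by norm_num)
  -- ### a classical pressure for the profile
  have hA : ∀ a : ℝ, 0 < a → ENNReal.ofReal (a ^ (2 * ρ)) *
      cknA a (0 : ℝ × EuclideanSpace ℝ (Fin 3)) u ≤ (c : ℝ≥0∞) :=
    fun a ha => le_trans (le_trans le_self_add le_self_add) (hgauge a ha)
  have hD : ∀ a : ℝ, 0 < a → ENNReal.ofReal (a ^ (2 * ρ)) *
      cknD a (0 : ℝ × EuclideanSpace ℝ (Fin 3)) p ≤ (c : ℝ≥0∞) :=
    fun a ha => le_trans le_add_self (hgauge a ha)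
  have hpm : AEStronglyMeasurable (uncurry p)
      (volume.restrict (Iio (0 : ℝ) ×ˢ (univ : Set (EuclideanSpace ℝ (Fin 3))))) := by
    have := hsw.distributional.2.2.1.aestronglyMeasurable
    simpa [slab] using this
  have hPm := aestronglyMeasurable_pressureProfile hpm hp
  have hDprof := profile_pressure_weight_of_gaugeD hρ hρ1' hpm hp hD
  have hP1 : LocallyIntegrable P volume :=
    EnergySaturation.locallyIntegrable_pressure_of_weight hρ1' hPm
      (ENNReal.mul_ne_top ENNReal.ofReal_ne_top ENNReal.coe_ne_top) hDprof
  obtain ⟨P', hprof⟩ :=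
    WeakToClassical.exists_isSelfSimilarEulerProfile_of_contDiff hsw.distributional hu hp hV hP1
  -- ### the class budgets of the profile on balls, WITHOUT the `+1` (here `0 < c`)
  obtain ⟨hA', hE'⟩ :=
    NeedleThinCore.selfSimilar_needle_inputs hρ hρ1' hsw hH hgauge hu hp hV1
  obtain ⟨CA, hCA⟩ : ∃ CA : ℝ, CA = (c : ℝ) := ⟨_, rfl⟩
  obtain ⟨CE, hCE⟩ : ∃ CE : ℝ, CE = (1 - ρ) / (2 + ρ) * (c : ℝ) := ⟨_, rfl⟩
  have hE0 : 0 ≤ (1 - ρ) / (2 + ρ) * (c : ℝ) := by positivity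
  have hCApos : 0 < CA := by rw [hCA]; exact hc
  have hCEpos : 0 < CE := by rw [hCE]; positivity
  have hbA : ∀ r : ℝ, 0 < r →
      ∫ x in ball (0 : EuclideanSpace ℝ (Fin 3)) r, ‖V x‖ ^ 2 ≤ CA * r ^ (1 - 2 * ρ) := by
    intro r hr
    have hX : 0 ≤ CA * r ^ (1 - 2 * ρ) := by positivity
    refine setIntegral_sq_le_of_lintegral hV.continuous hX ((hA' r hr).trans ?_)
    rw [hCA, ← ENNReal.ofReal_coe_nnreal, ← ENNReal.ofReal_mul (NNReal.coe_nonneg c)]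
  have hbE : ∀ r : ℝ, 1 ≤ r →
      ∫ x in ball (0 : EuclideanSpace ℝ (Fin 3)) r, ‖fderiv ℝ V x‖ ^ 2 ≤ CE * r ^ (1 - ρ) := by
    intro r hr
    have hr0 : (0 : ℝ) < r := by linarith
    have h1 := NeedleRace.lintegral_fderiv_sq_closedBall_le hρ1' hE0 hE' hr
    have h2 : ∫⁻ z in ball (0 : EuclideanSpace ℝ (Fin 3)) r, ‖fderiv ℝ V z‖ₑ ^ 2 ≤
        ENNReal.ofReal ((1 - ρ) / (2 + ρ) * (c : ℝ) * r ^ (1 - ρ)) :=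
      (lintegral_mono_set ball_subset_closedBall).trans h1
    have hY : 0 ≤ CE * r ^ (1 - ρ) := by positivity
    rw [hCE]
    exact setIntegral_sq_le_of_lintegral (hV.continuous_fderiv (by norm_num)) (by rw [← hCE]; exact hY) h2
  -- ### the exit ratio `Λ` and the exponents
  obtain ⟨κs, hκs⟩ : ∃ κs : ℝ, κs = 2 * Real.pi / (3 * (1 - ρ) * (2 + ρ) * (c : ℝ)) := ⟨_, rfl⟩
  rw [← hκs] at hc'κ
  have hκs0 : 0 < κs := by rw [hκs]; positivity
  obtain ⟨hΛ, hbook⟩ := exitRatio_bookkeeping hκs0 hc'κ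
  obtain ⟨Λ, hΛdef⟩ : ∃ Λ : ℝ, Λ = 3 * κs / (κs - c') + 1 := ⟨_, rfl⟩
  rw [← hΛdef] at hΛ hbook
  have hΛ1 : 0 < Λ + 1 := by linarith
  -- `κ_B(Λ) = κ⋆ (Λ³−1)/(Λ+1)^{1−ρ}` for `C_E = (1−ρ)c/(2+ρ)`, `γ = 1/(2+ρ)`
  have hκB : 2 * Real.pi * (1 / (2 + ρ)) ^ 2 * (Λ ^ 3 - 1) / (3 * (Λ + 1) ^ (1 - ρ) * CE) =
      κs * (Λ ^ 3 - 1) / (Λ + 1) ^ (1 - ρ) := by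
    have hL : 0 < (Λ + 1) ^ (1 - ρ) := Real.rpow_pos_of_pos hΛ1 _
    rw [hκs, hCE]
    field_simp
  -- the envelope exponent in the inner normalisation, `κ'' = c'(Λ+1)^{2+ρ}`, is below `κ_B(Λ)`
  have hpow3 : (Λ + 1) ^ (2 + ρ) * (Λ + 1) ^ (1 - ρ) = (Λ + 1) ^ 3 := by
    rw [← Real.rpow_add hΛ1, show (2 + ρ) + (1 - ρ) = ((3 : ℕ) : ℝ) by push_cast; ring, Real.rpow_natCast]
  have hκ'' : c' * (Λ + 1) ^ (2 + ρ) < 2 * Real.pi * (1 / (2 + ρ)) ^ 2 * (Λ ^ 3 - 1) / (3 * (Λ + 1) ^ (1 - ρ) * CE) := by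
    rw [hκB, lt_div_iff₀ (Real.rpow_pos_of_pos hΛ1 _), mul_assoc, hpow3]
    exact hbook
  obtain ⟨κm, hκm⟩ : ∃ κm : ℝ, κm = (c' * (Λ + 1) ^ (2 + ρ) + 2 * Real.pi * (1 / (2 + ρ)) ^ 2 * (Λ ^ 3 - 1) /
    (3 * (Λ + 1) ^ (1 - ρ) * CE)) / 2 := ⟨_, rfl⟩
  have hκm1 : c' * (Λ + 1) ^ (2 + ρ) < κm := by rw [hκm]; linarith
  have hκm2 : κm < 2 * Real.pi * (1 / (2 + ρ)) ^ 2 * (Λ ^ 3 - 1) / (3 * (Λ + 1) ^ (1 - ρ) * CE) := by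
    rw [hκm]; linarith
  -- ### THEOREM B′ at `κ_m`
  obtain ⟨R₁, hR₁, hB⟩ := sharpCondenserGaugeForm (1 / (2 + ρ)) ρ CA CE Λ κm hγ hρ.le hCApos hCEpos hΛ hκm2
  -- ### the profile is irrotational
  have hcurl : ∀ x : EuclideanSpace ℝ (Fin 3), curl V x = 0 := by
    intro x
    -- an outer radius handed out by the hypothesis, and the inner radius `R = R_out/(Λ+1)`
    obtain ⟨Rout, hRout, hgradR⟩ := hgrad ((Λ + 1) * max (max R₁ 1) (‖x‖ + 1))
    obtain ⟨R, hRdef⟩ : ∃ R : ℝ, R = Rout / (Λ + 1) := ⟨_, rfl⟩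
    have hRR : (Λ + 1) * R = Rout := by rw [hRdef]; field_simp
    have hRge : max (max R₁ 1) (‖x‖ + 1) ≤ R := by
      rw [hRdef, le_div_iff₀ hΛ1, mul_comm]; exact hRout
    have hRR₁ : R₁ ≤ R := ((le_max_left _ _).trans (le_max_left _ _)).trans hRge
    have hR1 : 1 ≤ R := ((le_max_right _ _).trans (le_max_left _ _)).trans hRge
    have hRx : ‖x‖ + 1 ≤ R := (le_max_right _ _).trans hRge
    have hR0 : 0 < R := by linarith
    have hRout1 : 1 ≤ (Λ + 1) * R := by nlinarith
    -- the envelope in the inner normalisation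
    have henv : ∀ z ∈ ball (0 : EuclideanSpace ℝ (Fin 3)) ((Λ + 1) * R),
        ‖fderiv ℝ V z‖ ≤ Real.exp (c' * (Λ + 1) ^ (2 + ρ) * R ^ (2 + ρ)) := by
      intro z hz
      have h := hgradR z (by rw [← hRR]; exact hz)
      rw [← hRR, Real.mul_rpow hΛ1.le hR0.le, ← mul_assoc] at h
      exact h
    -- a `C²` cut-off copy agreeing with `V` on `ball 0 ((Λ+1)R)`, with the class budgets
    obtain ⟨Vc, hVc2, -, -, ⟨K, hK⟩, hVU⟩ := Loc.exists_cutoff_local hV (R := (Λ + 1) * R) (by positivity)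
    have hVc1 : ContDiff ℝ 1 Vc := hVc2.of_le (by norm_num)
    have hfd : ∀ z ∈ ball (0 : EuclideanSpace ℝ (Fin 3)) ((Λ + 1) * R), fderiv ℝ Vc z = fderiv ℝ V z := fun z hz =>
      Filter.EventuallyEq.fderiv_eq (Filter.eventually_of_mem (isOpen_ball.mem_nhds hz) hVU)
    have hAc : ∫ z in ball (0 : EuclideanSpace ℝ (Fin 3)) ((Λ + 1) * R), ‖Vc z‖ ^ 2 ≤
        CA * ((Λ + 1) * R) ^ (1 - 2 * ρ) := by
      rw [setIntegral_congr_fun measurableSet_ball (fun z hz => by rw [hVU z hz])]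
      exact hbA _ (by positivity)
    have hEc : ∫ z in ball (0 : EuclideanSpace ℝ (Fin 3)) ((Λ + 1) * R), ‖fderiv ℝ Vc z‖ ^ 2 ≤
        CE * ((Λ + 1) * R) ^ (1 - ρ) := by
      rw [setIntegral_congr_fun measurableSet_ball (fun z hz => by rw [hfd z hz])]
      exact hbE _ hRout1
    -- NO EXIT through `‖·‖ = ΛR` at this scale, hence irrotational on `B(0,R)`
    have hnoexit := noexit_of_envelope (hB Vc K hVc1 hK R hRR₁ hAc hEc) hfd henv hκm1 hR0
    exact curl_eq_zero_of_noexit hprof hγ hγ2 hV hVc1 hK hR0 hΛ hVU hnoexit (by linarith)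
  -- ### conclusion
  exact Loc.selfSimilar_ae_eq_zero_of_irrotationalC2_profile hρ hsw.distributional hA hu hV hcurl


/-- **`NsregP2.R45.SharpExplicitGapLiouville`, binder-for-binder** (Sketch45 of nsreg-p2 g35, plate t47-K′;
`E3 = EuclideanSpace ℝ (Fin 3)` spelled out). [nsreg-p2 ROUND-45 THEOREM K′; cite: ConstantinIgnatovaVicol2026Putative,
§3.4.1; folklore (length–area method)] -/
theorem sharpExplicitGapLiouville :
    ∀ (ρ : ℝ), 0 < ρ → ρ ≤ 1 / 2 →
    ∀ (u : ℝ → EuclideanSpace ℝ (Fin 3) → EuclideanSpace ℝ (Fin 3)) (p : ℝ → EuclideanSpace ℝ (Fin 3) → ℝ)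
      (H : ℝ → EuclideanSpace ℝ (Fin 3) → EuclideanSpace ℝ (Fin 3) →L[ℝ] EuclideanSpace ℝ (Fin 3)) (c : ℝ≥0),
      0 < (c : ℝ) →
      IsSuitableWeakSolutionOn (slab (EuclideanSpace ℝ (Fin 3)) (Iio 0) isOpen_Iio) 0 0 u p →
      HasWeakSpatialGradientOn (slab (EuclideanSpace ℝ (Fin 3)) (Iio 0) isOpen_Iio) u H →
      (∀ a : ℝ, 0 < a →
        ENNReal.ofReal (a ^ (2 * ρ)) * cknA a (0 : ℝ × EuclideanSpace ℝ (Fin 3)) u +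
            ENNReal.ofReal (a ^ ρ) * cknE a (0 : ℝ × EuclideanSpace ℝ (Fin 3)) H +
          ENNReal.ofReal (a ^ (2 * ρ)) * cknD a (0 : ℝ × EuclideanSpace ℝ (Fin 3)) p ≤ (c : ℝ≥0∞)) →
      ∀ (V : EuclideanSpace ℝ (Fin 3) → EuclideanSpace ℝ (Fin 3)) (P : EuclideanSpace ℝ (Fin 3) → ℝ),
        (∀ τ : ℝ, τ < 0 → u τ = selfSimilarCollapse (1 / (2 + ρ)) 0 V τ) →
        (∀ τ : ℝ, τ < 0 → p τ = selfSimilarCollapsePressure (1 / (2 + ρ)) 0 P τ) →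
        ContDiff ℝ 2 V →
        (∃ c' : ℝ, c' < 2 * Real.pi / (3 * (1 - ρ) * (2 + ρ) * (c : ℝ)) ∧
          ∀ R₀ : ℝ, ∃ R : ℝ, R₀ ≤ R ∧
            ∀ z ∈ ball (0 : EuclideanSpace ℝ (Fin 3)) R, ‖fderiv ℝ V z‖ ≤ Real.exp (c' * R ^ (2 + ρ))) →
        uncurry u =ᵐ[volume.restrict (Iio (0 : ℝ) ×ˢ (univ : Set (EuclideanSpace ℝ (Fin 3))))] 0 :=
  fun _ hρ hρ1 _ _ _ _ hc hsw hH hgauge _ _ hu hp hV hgrad =>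
    selfSimilar_ae_eq_zero_of_sharpSmallTypeGradientC2 hρ hρ1 hc hsw hH hgauge hu hp hV hgrad

end Summit.NavierStokesRegularity.NavierStokesRegularity.Theorems.PowerGaugeEulerLiouville.Condenser

end
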